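import Summits.QuantumFields.BalabanUV.T4Continuum.Support.NE9PieceCouplingModulus
import Summits.QuantumFields.BalabanUV.T4Continuum.Support.NE9MarginalProjectionEnd

/-!
# NE9PieceCouplingModulusProj — leaf A3's CHANNEL COUPLING MODULUS `hTcup` ON THE v1.3 DICTIONARY `T := 𝒯 ∘ P` for the
owner's PIECE FORM `𝒯 := pieceChannel P` and the READ-OUT PROJECTION `P := margProj r A`, and the END-M read-out face with the
whole channel side (S3 ∕ S5 ∕ A3) at FORM LEVEL (cell `pub-balaban`, T4-DAG §2 node U3 ∕ §6 NE9; NE9 formalisation swarm, unit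
`b2b-balaban-t4-ne9-formalise-leaf-09` gen 4, own-initiative micro-item CLAIMS.log l.8245 «(w15) ON THE v1.3 DICTIONARY», at own risk;
skeleton `HOME/t4/b2b-balaban-t4-ne9-p1/SKELETON-NE9-P1.md` v1.3.4 rows A3 (R-4) ∕ RO ∕ AW ∕ MP, C5)

HONEST FRAMING (T4-DAG PAGE 1).  Rung (B)+1 on a FIXED finite torus — NOT infinite volume, NOT a mass gap, NOT the Clay
problem.  NE9 (`T4OutputRate.NE9` ∧ `FadingMemory`) is a cell NEW ESTIMATE, NOT PRINTED, NOT discharged here.  Bookkeeping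
over the ABSTRACT carriers of `T4OutputRate`, the row owner's piece form `NE9Lemma1Counting.pieceChannel` ∕ `NE9Lemma1Gain` and
projection structure `NE9MarginalProjection`; every analytic input is a DISPLAYED binder stated INLINE (no Prop-valued
definition; trigger c3 ∕ referee DV-9).  [I] = [Balaban1987RG1], [II] = [Balaban1988RG2Cluster] are quoted for TYPES only
(ABSOLUTE RULE).  `FlowStep.BetaPertH`, (B), (B^μ) do not occur.

WHERE THIS SITS.  After the owner's located correction O-ne9p1g22-1 the frame's channel is `T := 𝒯 ∘ P` (skeleton C5): the
localized curly bracket `𝒯` ((1.33) p. 9 of [II]) on MARGINAL-FREE inputs, fed with the projected old terms `P (E g)`,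
`P = margProj r A` re-attaching the counterterm of (1.3) p. 260 of [I] through node U2's read-out `r` ((1.20)–(1.22) p. 264)
along the marginal direction `A`; the owner's END-M face `NE9MarginalProjectionEnd.…_vacSub_sizeInduction_margProj` DISPLAYS
leaf A3's binder `hTcup` for THIS `T`.  Crew row (w15) (`NE9PieceCouplingModulus`, unit leaf-03-g3) derives `hTcup` for the
owner's PIECE FORM `𝒯 := pieceChannel P` — for ANY history-indexed input family — from ONE displayed per-piece COUPLING-RESPONSE
bound of the (1.24)×(1.25) shape plus the [II] p. 8 level counts `LevelCountsG`, with the k-UNIFORM constant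
`qc·c_Q·(1 − ω)⁻¹`.  THIS FILE feeds that theorem the PROJECTED family `margProj r A (E g)`: since
`margProj r A (E g) U x = E g U x − r_j(E g↾j)·A U x` with a BACKGROUND-FREE read-out coefficient (the mechanism of leaf-03-g3's
`NE9EvalChannelCouplingModulusProj.lipFamily_margProj`, now PER PIECE) and the pieces are additive, the per-piece response of
the projected family is bounded by (the terms' per-piece response) + |r_j(E g↾j)|·(the marginal direction's per-piece
response), and `|r_j(E g↾j)| ≤ cr·N j ≤ cr·Nbar` by RO `ReadSize` on the size profile `TermSize E W κ N` — letter
`qc + cr·Nbar·qcA` (§1).  §2 is (w15)'s theorem at `H g := margProj r A (E g)`: LITERALLY END-M's `hTcup` at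
`𝒯 := pieceChannel P`.  §3 applies END-M BY NAME with S3 (`channelAdditive_piece` ∕ `channelStepSum_piece`) and S5
(`channelSizeAtStepNN_pieceG`) taken ON THE MARGINAL-FREE CLASS `MF` — the owner's any-class piece lemmas at the class where
O-ne9p1g22-1 places the per-piece size bound — the profile `tauOfG c_Q (agePow ω)` (`profileG`; letter ω = L^{−α},
O-ne9p1g23-1), and A3 := §2; the size profile `TermSize E W κ N` needed by §1 is derived FIRST inside the face from the
one-history binders by END-M's own internal route (`termSize_of_recursion_vacSub` ∘ `channelSizeNN_of_perStepNN` ∘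
`channelStepSum_compProj` ∕ `channelSizeAtStepNN_compProj`) — no circularity; one new displayed scalar `hNb : N j ≤ Nbar`.
AFTER §3 the dictionary face's channel side displays ONLY: `SrcScale P`, `PieceBoundG` (S5's per-piece size bound — for
marginal-free ∕ projected inputs, O-ne9p1g22-1), the two per-piece coupling responses (terms; scalar multiples of the marginal
direction — pieces are only ADDITIVE, so homogeneity is displayed, as in row AW), `LevelCountsG`, RO (`ReadAdditive`,
`ReadZero`, `ReadSize`), AW (`DirSize`), MP (`ProjInto`), scalars.  NOT PRINTED and not claimed: anything about Bałaban's
(1.23) ∕ (1.33) ∕ (1.20); instances O-NE9-5 ∕ (w8) ∕ (w9) stay gated on the model O-NE9-1.  DISGUISE TEST: every coupling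
clause compares two coupling ARGUMENTS `g k`, `g′ k` on the SAME family; sizes are one-history; no joint two-history
statement; not NE9.

RIDER (the row owner's located FINDING F-ne9p1g24-1, CLAIMS.log l.8319, posted while this file was in dry-run): g23's
CLASS-FREE piece form (`PieceData.piece : (Bg → ℝ) →+ ℝ`, `PieceBoundG` over ALL bounded inputs) cannot host the displayed
species ((1.24)'s gain is a Taylor-remainder gain of ANALYTIC inputs; contour-integral pieces are additive on integrable
inputs only); the owner re-cuts it to a CLASS-RELATIVE form (`NE9Lemma1PieceClass`, pieces additive ∕ bounded on `Adm`) with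
the →+ form embedded as the class-free special case.  THIS FILE, like crew row (w15), lives on the →+ form; its §1 uses
additivity only to split `E g U x − c·A U x`, so it ports verbatim to the class-relative form with the two memberships
`(U ↦ E g U x)`-family ∈ `Adm` (S1) and `ℝ·A ⊆ Adm` (as in `NE9MarginalFreeClass.projInto_margProj_of_readAdditive`) — to be
filed as a twin when (A) lands; nothing here is claimed for Bałaban's pieces.

WHAT IS PROVED (kernel, `[folklore]` bookkeeping; 0 sorry, 0 `def`).
§1 `pieceResponse_margProj`.
§2 **`channelCouplingModulus_piece_margProj`** (= END-M `_margProj`'s `hTcup` at `𝒯 := pieceChannel P`,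
   `qT := fun _ => (qc + cr·Nbar·qcA)·c_Q·(1−ω)⁻¹`).
§3 END face **`termSize_ne9_and_fadingMemory_of_couplingTwoPoint_vacSub_sizeInduction_margProj_pieceForm`** = END-M BY NAME;
   conclusion END-M's with `τbar := c_Q`, `qTbar := (qc + cr·Nbar·qcA)·c_Q·(1−ω)⁻¹`.

References (TYPES only): [Balaban1987RG1] CMP 109 (1987) (0.29)–(0.30) p. 258, (1.3) p. 260, (1.18) p. 263, (1.20)–(1.22) p. 264,
(2.12)–(2.13) p. 268; [Balaban1988RG2Cluster] CMP 116 (1988) (1.23)–(1.25) p. 7, (1.26)–(1.29) and l. 1–10 p. 8, (1.33)–(1.36) p. 9,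
Lemma 3 (2.38) p. 20.
-/

noncomputable section

namespace Summit.QuantumFields.BalabanUV.T4Continuum.NE9PieceCouplingModulusProj

open scoped BigOperators
open Literature.MathematicalPhysics.QuantumFieldTheory.Balaban1983to89
open Literature.MathematicalPhysics.QuantumFieldTheory.Balaban1983to89.T4OutputRate
open Literature.MathematicalPhysics.QuantumFieldTheory.Balaban1983to89.T4HistoryLipschitzRecursion
open Literature.MathematicalPhysics.QuantumFieldTheory.Balaban1983to89.T4HistoryLipschitzOuter
open Literature.MathematicalPhysics.QuantumFieldTheory.Balaban1983to89.T4HistoryLipschitzActivity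
open Literature.MathematicalPhysics.QuantumFieldTheory.Balaban1983to89.T4HistoryLipschitzActivity (ClusterGeom)
open Literature.MathematicalPhysics.QuantumFieldTheory.Balaban1983to89.T4HistoryLipschitzSegment
open Summit.QuantumFields.BalabanUV.T4Continuum.NE9Lemma1Counting
open Summit.QuantumFields.BalabanUV.T4Continuum.NE9Lemma1Gain
open Summit.QuantumFields.BalabanUV.T4Continuum.NE9LastCouplingBridge
open Summit.QuantumFields.BalabanUV.T4Continuum.NE9BridgeSizeInduction
open Summit.QuantumFields.BalabanUV.T4Continuum.NE9MarginalProjection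
open Summit.QuantumFields.BalabanUV.T4Continuum.NE9MarginalProjectionEnd
open Summit.QuantumFields.BalabanUV.T4Continuum.NE9PieceCouplingModulus

variable {C : Carriers} {Bg ι α β γ : Type}

/-! ## §1 The per-piece coupling response of the read-out-projected family -/

/-- **PER-PIECE COUPLING RESPONSE OF THE PROJECTED OLD TERMS (kernel).**  DISPLAYED (inline, asserted nowhere for Bałaban's
objects): (i) the terms' per-piece coupling response `hrespE` — crew row (w15)'s binder at `H := E` (TYPE: [II] (1.24)×(1.25)
read for the s-derivative of the piece through 𝐇_k(s), per unit `qc` of the S5 size constant `Kp`; PROOF-INTERIOR (I.3.54));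
(ii) the per-piece coupling response of the SCALAR MULTIPLES of the marginal direction `hrespA` (`|c|` times the same shape
with `qcA`; the one-cube Wilson action is analytic in the background on (1.11)–(1.14) p. 262 of [I] — elementary with the model,
like row AW; the pieces are only additive, so the scalar is displayed); (iii) RO `ReadSize Adm r κ cr` on the size profile
`TermSize E W κ N` with `N j ≤ Nbar`.  Since `margProj r A (E g) U x = E g U x − r_j(E g↾j)·A U x` (`j = scale x`) with a
background-free coefficient and the piece is additive, the projected family's per-piece response is bounded by the shape
of (w15)'s `hresp` with `qc ↦ qc + cr·Nbar·qcA`.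
[cite: Balaban1987RG1, (1.18) p.263, (1.20)-(1.22) p.264, (2.12)-(2.13) p.268; Balaban1988RG2Cluster, (1.23)-(1.25) p.7] -/
theorem pieceResponse_margProj (P : PieceData C Bg ι α β γ) {E : Functional C Bg} {W : Set (ℕ → ℝ)}
    {Adm : Set (Bg → C.Dom → ℝ)} {r : ℕ → (Bg → C.Dom → ℝ) → ℝ} {A : Bg → C.Dom → ℝ}
    {κ κ₁ d0 cr qc qcA Nbar : ℝ} {Kp : ℕ → ι → ℝ} {gain : ℕ → ℕ → ℝ} {N : ℕ → ℝ}
    (hrespE : ∀ g ∈ W, ∀ g' ∈ W, ∀ (k : ℕ) (y : ι), ∀ a ∈ P.S0 k y, ∀ b ∈ P.SY k y a, ∀ (j : ℕ), ∀ x ∈ P.src k y a j,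
      |P.piece k g y a b x (fun U => E g U x) - P.piece k g' y a b x (fun U => E g U x)| ≤
        Kp k y * qc * gain k j * Real.exp (-(κ * C.d x)) *
          Real.exp (-(1 / 8) * (κ₁ - 1) * P.dY k y + (1 / 8) * κ₁ * d0 - (1 / 2) * (κ₁ - 1) * P.vol k y a b) *
            |g k - g' k|)
    (hrespA : ∀ g ∈ W, ∀ g' ∈ W, ∀ (k : ℕ) (y : ι), ∀ a ∈ P.S0 k y, ∀ b ∈ P.SY k y a, ∀ (j : ℕ), ∀ x ∈ P.src k y a j,
      ∀ c : ℝ, |P.piece k g y a b x (fun U => c * A U x) - P.piece k g' y a b x (fun U => c * A U x)| ≤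
        |c| * (Kp k y * qcA * gain k j * Real.exp (-(κ * C.d x)) *
          Real.exp (-(1 / 8) * (κ₁ - 1) * P.dY k y + (1 / 8) * κ₁ * d0 - (1 / 2) * (κ₁ - 1) * P.vol k y a b) *
            |g k - g' k|))
    (hAdmE : ∀ g ∈ W, E g ∈ Adm) (hrs : ReadSize Adm r κ cr) (hT : TermSize E W κ N) (hN0 : ∀ j, 0 ≤ N j)
    (hNb : ∀ j, N j ≤ Nbar) (hcr : 0 ≤ cr) (hKp : ∀ k y, 0 ≤ Kp k y) (hqcA : 0 ≤ qcA) (hgain : ∀ k j, 0 ≤ gain k j) :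
    ∀ g ∈ W, ∀ g' ∈ W, ∀ (k : ℕ) (y : ι), ∀ a ∈ P.S0 k y, ∀ b ∈ P.SY k y a, ∀ (j : ℕ), ∀ x ∈ P.src k y a j,
      |P.piece k g y a b x (fun U => margProj r A (E g) U x) - P.piece k g' y a b x (fun U => margProj r A (E g) U x)| ≤
        Kp k y * (qc + cr * Nbar * qcA) * gain k j * Real.exp (-(κ * C.d x)) *
          Real.exp (-(1 / 8) * (κ₁ - 1) * P.dY k y + (1 / 8) * κ₁ * d0 - (1 / 2) * (κ₁ - 1) * P.vol k y a b) *
            |g k - g' k| := by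
  intro g hg g' hg' k y a ha b hb j x hx
  -- the read-out coefficient of the creation-step slice of `x`: background-free
  have hρ : |r (C.scale x) (restrictScale (C.scale x) (E g))| ≤ cr * Nbar := by
    have h := hrs (C.scale x) (E g) (hAdmE g hg) (N (C.scale x)) (hN0 _)
      (fun V Y hY => by rw [← hY]; exact hT g hg V Y)
    exact h.trans (mul_le_mul_of_nonneg_left (hNb _) hcr)
  -- the projected family on the domain `x` as a difference of two functions of the background
  have hfun : (fun U => margProj r A (E g) U x) =
      (fun U => E g U x) - (fun U => r (C.scale x) (restrictScale (C.scale x) (E g)) * A U x) := by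
    funext U
    simp only [margProj, Pi.sub_apply]
  rw [hfun, map_sub, map_sub]
  have hrew : P.piece k g y a b x (fun U => E g U x) -
        P.piece k g y a b x (fun U => r (C.scale x) (restrictScale (C.scale x) (E g)) * A U x) -
      (P.piece k g' y a b x (fun U => E g U x) -
        P.piece k g' y a b x (fun U => r (C.scale x) (restrictScale (C.scale x) (E g)) * A U x)) =
      (P.piece k g y a b x (fun U => E g U x) - P.piece k g' y a b x (fun U => E g U x)) -
      (P.piece k g y a b x (fun U => r (C.scale x) (restrictScale (C.scale x) (E g)) * A U x) -
        P.piece k g' y a b x (fun U => r (C.scale x) (restrictScale (C.scale x) (E g)) * A U x)) := by ring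
  rw [hrew]
  have hG : 0 ≤ Kp k y * qcA * gain k j * Real.exp (-(κ * C.d x)) *
      Real.exp (-(1 / 8) * (κ₁ - 1) * P.dY k y + (1 / 8) * κ₁ * d0 - (1 / 2) * (κ₁ - 1) * P.vol k y a b) *
        |g k - g' k| := by
    have := hKp k y; have := hgain k j; positivity
  calc |(P.piece k g y a b x (fun U => E g U x) - P.piece k g' y a b x (fun U => E g U x)) -
        (P.piece k g y a b x (fun U => r (C.scale x) (restrictScale (C.scale x) (E g)) * A U x) -
          P.piece k g' y a b x (fun U => r (C.scale x) (restrictScale (C.scale x) (E g)) * A U x))|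
      ≤ |P.piece k g y a b x (fun U => E g U x) - P.piece k g' y a b x (fun U => E g U x)| +
        |P.piece k g y a b x (fun U => r (C.scale x) (restrictScale (C.scale x) (E g)) * A U x) -
          P.piece k g' y a b x (fun U => r (C.scale x) (restrictScale (C.scale x) (E g)) * A U x)| := abs_sub _ _
    _ ≤ Kp k y * qc * gain k j * Real.exp (-(κ * C.d x)) *
          Real.exp (-(1 / 8) * (κ₁ - 1) * P.dY k y + (1 / 8) * κ₁ * d0 - (1 / 2) * (κ₁ - 1) * P.vol k y a b) *
            |g k - g' k| +
        cr * Nbar * (Kp k y * qcA * gain k j * Real.exp (-(κ * C.d x)) *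
          Real.exp (-(1 / 8) * (κ₁ - 1) * P.dY k y + (1 / 8) * κ₁ * d0 - (1 / 2) * (κ₁ - 1) * P.vol k y a b) *
            |g k - g' k|) :=
        add_le_add (hrespE g hg g' hg' k y a ha b hb j x hx)
          ((hrespA g hg g' hg' k y a ha b hb j x hx _).trans (mul_le_mul_of_nonneg_right hρ hG))
    _ = Kp k y * (qc + cr * Nbar * qcA) * gain k j * Real.exp (-(κ * C.d x)) *
          Real.exp (-(1 / 8) * (κ₁ - 1) * P.dY k y + (1 / 8) * κ₁ * d0 - (1 / 2) * (κ₁ - 1) * P.vol k y a b) *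
            |g k - g' k| := by ring

/-! ## §2 `hTcup` for the piece form on the read-out dictionary -/

/-- **LEAF A3 ON THE v1.3 DICTIONARY, PIECE FORM (kernel; the theorem of this file).**  Crew row (w15)'s
`NE9PieceCouplingModulus.channelCouplingModulus_piece` at the PROJECTED input family `H g := margProj r A (E g)`, its per-piece
coupling-response binder supplied by §1.  CONCLUSION: LITERALLY the binder `hTcup` of the owner's END-M face
`NE9MarginalProjectionEnd.ne9_and_fadingMemory_of_couplingTwoPoint_vacSub_sizeInduction_margProj` at `𝒯 := pieceChannel P`, with
the S5 weight `wt := weightOf P κ₁ d₀ O1 Kp` and the k-UNIFORM `qT k := (qc + cr·Nbar·qcA)·c_Q·(1 − ω)⁻¹` (creation steps summed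
by the (0.30) profile, `sum_tauOfG_le`).  Displayed: `hrespE`, `hrespA`, `ReadSize`, `TermSize` (+ `N j ≤ Nbar`), `LevelCountsG`,
scalars.  [cite: Balaban1987RG1, (0.30) p.258, (1.20)-(1.22) p.264, (2.12)-(2.13) p.268; Balaban1988RG2Cluster, (1.23)-(1.29) pp.7-8, (1.33)-(1.36) p.9] -/
theorem channelCouplingModulus_piece_margProj (P : PieceData C Bg ι α β γ) {E : Functional C Bg} {W : Set (ℕ → ℝ)}
    {Adm : Set (Bg → C.Dom → ℝ)} {r : ℕ → (Bg → C.Dom → ℝ) → ℝ} {A : Bg → C.Dom → ℝ}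
    {κ κ₁ d0 O1 cQ ω cr qc qcA Nbar : ℝ} {Kp : ℕ → ι → ℝ} {gain : ℕ → ℕ → ℝ} {N : ℕ → ℝ}
    (hrespE : ∀ g ∈ W, ∀ g' ∈ W, ∀ (k : ℕ) (y : ι), ∀ a ∈ P.S0 k y, ∀ b ∈ P.SY k y a, ∀ (j : ℕ), ∀ x ∈ P.src k y a j,
      |P.piece k g y a b x (fun U => E g U x) - P.piece k g' y a b x (fun U => E g U x)| ≤
        Kp k y * qc * gain k j * Real.exp (-(κ * C.d x)) *
          Real.exp (-(1 / 8) * (κ₁ - 1) * P.dY k y + (1 / 8) * κ₁ * d0 - (1 / 2) * (κ₁ - 1) * P.vol k y a b) *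
            |g k - g' k|)
    (hrespA : ∀ g ∈ W, ∀ g' ∈ W, ∀ (k : ℕ) (y : ι), ∀ a ∈ P.S0 k y, ∀ b ∈ P.SY k y a, ∀ (j : ℕ), ∀ x ∈ P.src k y a j,
      ∀ c : ℝ, |P.piece k g y a b x (fun U => c * A U x) - P.piece k g' y a b x (fun U => c * A U x)| ≤
        |c| * (Kp k y * qcA * gain k j * Real.exp (-(κ * C.d x)) *
          Real.exp (-(1 / 8) * (κ₁ - 1) * P.dY k y + (1 / 8) * κ₁ * d0 - (1 / 2) * (κ₁ - 1) * P.vol k y a b) *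
            |g k - g' k|))
    (hAdmE : ∀ g ∈ W, E g ∈ Adm) (hrs : ReadSize Adm r κ cr) (hT : TermSize E W κ N) (hN0 : ∀ j, 0 ≤ N j)
    (hNb : ∀ j, N j ≤ Nbar) (hcr : 0 ≤ cr) (hL : LevelCountsG P κ κ₁ O1 cQ gain (agePow ω))
    (hKp : ∀ k y, 0 ≤ Kp k y) (hqc : 0 ≤ qc) (hqcA : 0 ≤ qcA) (hO1 : 0 ≤ O1) (hgain : ∀ k j, 0 ≤ gain k j)
    (hcQ : 0 ≤ cQ) (hω0 : 0 ≤ ω) (hω1 : ω < 1) :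
    ∀ g ∈ W, ∀ g' ∈ W, ∀ (k : ℕ) (y : ι),
      |compProj (pieceChannel P) (margProj r A) k g (E g) y - compProj (pieceChannel P) (margProj r A) k g' (E g) y| ≤
        weightOf P κ₁ d0 O1 Kp k y * ((qc + cr * Nbar * qcA) * cQ * (1 - ω)⁻¹ * |g k - g' k|) := by
  have hNbar : 0 ≤ Nbar := (hN0 0).trans (hNb 0)
  have hq : 0 ≤ qc + cr * Nbar * qcA := by positivity
  exact channelCouplingModulus_piece P (H := fun g => margProj r A (E g))
    (pieceResponse_margProj P hrespE hrespA hAdmE hrs hT hN0 hNb hcr hKp hqcA hgain) hL hKp hq hO1 hgain hcQ hω0 hω1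

/-! ## §3 The END-M read-out face with the channel side at form level -/

section EndFace

variable (G : ClusterGeom C) {Pot : Type*} [NormedAddCommGroup Pot] [NormedSpace ℂ Pot]

/-- **NE9 ∧ FADING MEMORY ∧ TERM SIZE ON THE v1.3 DICTIONARY, CHANNEL SIDE AT FORM LEVEL (kernel end-to-end).**  The owner's
END-M face `NE9MarginalProjectionEnd.ne9_and_fadingMemory_of_couplingTwoPoint_vacSub_sizeInduction_margProj` APPLIED BY NAME at
`𝒯 := pieceChannel P`, `wt := weightOf P κ₁ d₀ O1 Kp`, `τ := tauOfG c_Q (agePow ω)` with: S3 `ChannelAdditive MF 𝒯` ∕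
`ChannelStepSum MF 𝒯` := `channelAdditive_piece` ∕ `channelStepSum_piece` (from `SrcScale`), S5 `ChannelSizeAtStepNN MF 𝒯 κ wt τ` :=
the owner's `channelSizeAtStepNN_pieceG` ON THE MARGINAL-FREE CLASS (from the displayed `PieceBoundG` + `LevelCountsG`), the
profile binders from `profileG` (`τbar := c_Q`), and A3 `hTcup` := §2 — whose `TermSize E W κ N` input is derived FIRST from the
one-history binders by END-M's own internal route (`termSize_of_recursion_vacSub` ∘ `channelSizeNN_of_perStepNN` ∘
`channelStepSum_compProj` ∕ `channelSizeAtStepNN_compProj` ∘ `projScaleComm_margProj` ∕ `projSize_margProj`), so no `TermSize`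
hypothesis appears; one new displayed scalar `hNb : N j ≤ Nbar`.  Every other END-M binder VERBATIM (RO `hrA hr0 hrs`, AW `hA`,
MP `hPinto`, `hfac`, the activities' `hCup` ∕ `TwoPointKP`, `hreprV`, geometry `hdec` ∕ `hpin`, reading `hρ` (at the weight
`weightOf …`), (B0) ∕ (XZ) ∕ (N′) ∕ (R′), scalars).  Conclusion = END-M's with `τbar := c_Q`, `qTbar := (qc + cr·Nbar·qcA)·c_Q·(1−ω)⁻¹`.
Displayed on the channel side after this face: `SrcScale P`, `PieceBoundG P κ κ₁ d₀ Kp gain` (S5's per-piece size bound — for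
marginal-free ∕ projected inputs, O-ne9p1g22-1), `hrespE`, `hrespA`, `LevelCountsG P κ κ₁ O1 c_Q gain (agePow ω)`, `0 ≤ ω < 1`,
`qc`, `qcA`, `c_Q`, `O1`, `Kp ≥ 0`, `Nbar`.  Nothing of [I]–[II] asserted; NE9 NOT PROVED; 0∕9 unchanged.
[cite: Balaban1987RG1, (0.28)-(0.30) p.258, (1.3) p.260, (1.18) p.263, (1.20)-(1.22) p.264, (2.12)-(2.14) p.268; Balaban1988RG2Cluster, (1.23)-(1.29) pp.7-8, (1.33)-(1.36) p.9, Lemma 3 (2.38) p.20] -/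
theorem termSize_ne9_and_fadingMemory_of_couplingTwoPoint_vacSub_sizeInduction_margProj_pieceForm
    (P : PieceData C Bg ι α β γ) {E : Functional C Bg} {W : Set (ℕ → ℝ)} {Adm MF : Set (Bg → C.Dom → ℝ)}
    {r : ℕ → (Bg → C.Dom → ℝ) → ℝ} {A : Bg → C.Dom → ℝ}
    {Ψ : ℕ → ℝ → (ι → ℝ) → Bg → C.Dom → ℝ} {act : ℕ → ℝ → Bg → Pot → G.P → ℂ} {𝒜 : ℕ → Set Pot}
    {n : ℕ → ℝ → Bg → G.P → ℝ} {lip clip : ℕ → ℝ} {a d : G.P → ℝ} {δ : C.Dom → ℝ}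
    {κ κ₁ d0 O1 cQ ω qc qcA Nbar B lipbar clipbar cr aA : ℝ} {Kp : ℕ → ι → ℝ} {gain : ℕ → ℕ → ℝ} {p₀ N : ℕ → ℝ}
    (ρ : ℕ → (ι → ℝ) → Pot) (U₀ : Bg) (explZ : ℕ → Bg → C.Dom → ℝ) (h0 : ScaleZeroFree E W)
    (hAdm : AdmissibleTerms E W Adm) (hres : AdmRestrict Adm)
    -- the read-out, the marginal direction, the marginal-free class (owner's v1.3, verbatim)
    (hrA : ReadAdditive Adm r) (hr0 : ReadZero r) (hrs : ReadSize Adm r κ cr) (hA : DirSize A κ aA) (hcr : 0 ≤ cr)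
    (haA : 0 ≤ aA) (hPinto : ProjInto Adm MF (margProj r A))
    -- the channel side at FORM LEVEL: source discipline, S5's per-piece size bound, the level counts, the two coupling responses
    (hsrc : SrcScale P) (hPiece : PieceBoundG P κ κ₁ d0 Kp gain) (hL : LevelCountsG P κ κ₁ O1 cQ gain (agePow ω))
    (hrespE : ∀ g ∈ W, ∀ g' ∈ W, ∀ (k : ℕ) (y : ι), ∀ a' ∈ P.S0 k y, ∀ b ∈ P.SY k y a', ∀ (j : ℕ), ∀ x ∈ P.src k y a' j,
      |P.piece k g y a' b x (fun U => E g U x) - P.piece k g' y a' b x (fun U => E g U x)| ≤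
        Kp k y * qc * gain k j * Real.exp (-(κ * C.d x)) *
          Real.exp (-(1 / 8) * (κ₁ - 1) * P.dY k y + (1 / 8) * κ₁ * d0 - (1 / 2) * (κ₁ - 1) * P.vol k y a' b) *
            |g k - g' k|)
    (hrespA : ∀ g ∈ W, ∀ g' ∈ W, ∀ (k : ℕ) (y : ι), ∀ a' ∈ P.S0 k y, ∀ b ∈ P.SY k y a', ∀ (j : ℕ), ∀ x ∈ P.src k y a' j,
      ∀ c : ℝ, |P.piece k g y a' b x (fun U => c * A U x) - P.piece k g' y a' b x (fun U => c * A U x)| ≤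
        |c| * (Kp k y * qcA * gain k j * Real.exp (-(κ * C.d x)) *
          Real.exp (-(1 / 8) * (κ₁ - 1) * P.dY k y + (1 / 8) * κ₁ * d0 - (1 / 2) * (κ₁ - 1) * P.vol k y a' b) *
            |g k - g' k|))
    (hKp : ∀ k y, 0 ≤ Kp k y) (hqc : 0 ≤ qc) (hqcA : 0 ≤ qcA) (hO1 : 0 ≤ O1) (hgain : ∀ k j, 0 ≤ gain k j)
    (hcQ : 0 ≤ cQ) (hω0 : 0 ≤ ω) (hω1 : ω < 1) (hNb : ∀ j, N j ≤ Nbar)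
    -- g21's remaining binders at `T := pieceChannel P ∘ margProj r A` (END-M, verbatim)
    (hfac : Factorises E W (compProj (pieceChannel P) (margProj r A)) Ψ) (hclip0 : ∀ k, 0 ≤ clip k)
    (hCup : ∀ g ∈ W, ∀ g' ∈ W, ∀ (k : ℕ) (U : Bg) (X : C.Dom), C.scale X = k + 1 → ∀ Q ∈ 𝒜 k, ∀ γ' ∈ G.vol X,
      ‖act k (g k) U Q γ'‖ ≤ n k (g' k) U γ' ∧
        ‖act k (g k) U Q γ' - act k (g' k) U Q γ'‖ ≤ clip k * |g k - g' k| * n k (g' k) U γ')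
    (hreprV : ∀ (k : ℕ) (s : ℝ) (Q : ι → ℝ) (U : Bg) (X : C.Dom),
      Ψ k s Q U X = (G.newTerm act k s U X (ρ k Q)).re - (G.newTerm act k s U₀ X (ρ k Q)).re + explZ k U X)
    (hclipb : ∀ k, clip k ≤ clipbar)
    (hK : TwoPointKP G W act 𝒜 n lip a d) (hdec : G.DecayExtract δ d) (hpin : G.PinBudget a δ (fun _ => B) κ)
    (hρ : ∀ (k : ℕ) (Q Q' : ι → ℝ) (M : ℝ),
      (∀ y, |Q y - Q' y| ≤ weightOf P κ₁ d0 O1 Kp k y * M) → ‖ρ k Q - ρ k Q'‖ ≤ M)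
    (hexplZ : ∀ (k : ℕ) (U : Bg) (X : C.Dom), C.scale X = k + 1 → |explZ k U X| ≤ Real.exp (-(κ * C.d X)) * p₀ k)
    (hbase : ∀ g ∈ W, ∀ (U : Bg) (X : C.Dom), C.scale X = 0 → |E g U X| ≤ Real.exp (-(κ * C.d X)) * N 0)
    (hNsucc : ∀ j, p₀ j + 2 * B ≤ N (j + 1)) (hNnn : ∀ j, 0 ≤ N j)
    (hbox : ∀ (k : ℕ) (Q : ι → ℝ),
      (∀ y, |Q y| ≤ weightOf P κ₁ d0 O1 Kp k y *
        sizeRadius (fun k j => (1 + cr * aA) * tauOfG cQ (agePow ω) k j) N k) → ρ k Q ∈ 𝒜 k)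
    (hB : 0 ≤ B) (hlipb : ∀ k, lip k ≤ lipbar) (hpos : 0 < ω + 8 * lipbar * B * ((1 + cr * aA) * cQ)) :
    TermSize E W κ N ∧
      NE9 E W κ (prodModuli (8 * clipbar * B + 8 * lipbar * B * ((qc + cr * Nbar * qcA) * cQ * (1 - ω)⁻¹))
        fun _ => ω + 8 * lipbar * B * ((1 + cr * aA) * cQ)) ∧
        FadingMemory ((8 * clipbar * B + 8 * lipbar * B * ((qc + cr * Nbar * qcA) * cQ * (1 - ω)⁻¹)) /
            (ω + 8 * lipbar * B * ((1 + cr * aA) * cQ)))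
          (ω + 8 * lipbar * B * ((1 + cr * aA) * cQ))
          (prodModuli (8 * clipbar * B + 8 * lipbar * B * ((qc + cr * Nbar * qcA) * cQ * (1 - ω)⁻¹))
            fun _ => ω + 8 * lipbar * B * ((1 + cr * aA) * cQ)) := by
  have hcQℓ : ∀ k j, 0 ≤ cQ * agePow ω k j := fun k j => mul_nonneg hcQ (agePow_nonneg hω0 k j)
  -- S3 / S5 on the marginal-free class, from the owner's any-class piece lemmas
  have hadd : ChannelAdditive MF (pieceChannel P) := channelAdditive_piece P MF
  have hsum : ChannelStepSum MF (pieceChannel P) := channelStepSum_piece hsrc MF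
  have hstep : ChannelSizeAtStepNN MF (pieceChannel P) κ (weightOf P κ₁ d0 O1 Kp) (tauOfG cQ (agePow ω)) :=
    channelSizeAtStepNN_pieceG hsrc hPiece hL hKp hO1 hgain hcQℓ MF
  have hτ : ∀ k j, j ≤ k → 0 ≤ tauOfG cQ (agePow ω) k j ∧ tauOfG cQ (agePow ω) k j ≤ cQ * ω ^ (k - j) :=
    fun k j hjk => ⟨hcQℓ k j, (profileG hcQ hω0).1 k j hjk⟩
  -- the size profile FIRST (END-M's own internal route; one-history binders only)
  have hPcomm : ProjScaleComm Adm (margProj r A) := projScaleComm_margProj Adm A hr0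
  have hPsize : ProjSize Adm (margProj r A) κ (cr * aA) := projSize_margProj hrs hA hcr
  have hc : 0 ≤ cr * aA := mul_nonneg hcr haA
  have hT : TermSize E W κ N :=
    (termSize_of_recursion_vacSub G ρ U₀ explZ hAdm
      (channelSizeNN_of_perStepNN hres (channelStepSum_compProj hPcomm hPinto hsum)
        (channelSizeAtStepNN_compProj hPcomm hPinto hPsize hc hstep))
      hfac hK hdec hpin hreprV hexplZ hbase hNsucc hNnn hbox).1
  -- A3 on the dictionary (§2)
  have hTcup := channelCouplingModulus_piece_margProj P hrespE hrespA hAdm.1 hrs hT hNnn hNb hcr hL hKp hqc hqcA hO1 hgain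
    hcQ hω0 hω1
  have hNbar : 0 ≤ Nbar := (hNnn 0).trans (hNb 0)
  have hq0 : 0 ≤ (qc + cr * Nbar * qcA) * cQ * (1 - ω)⁻¹ := by
    have : 0 < 1 - ω := by linarith
    positivity
  exact ne9_and_fadingMemory_of_couplingTwoPoint_vacSub_sizeInduction_margProj G
    (qT := fun _ => (qc + cr * Nbar * qcA) * cQ * (1 - ω)⁻¹) ρ U₀ explZ h0 hAdm hres hrA hr0 hrs hA hcr haA hPinto hadd hsum
    hstep hfac hclip0 hCup (fun _ => hq0) hTcup hreprV hclipb (fun _ => le_rfl) hK hdec hpin hρ hexplZ hbase hNsucc hNnn hbox hB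
    hlipb hcQ hω0 hpos hτ

end EndFace

end Summit.QuantumFields.BalabanUV.T4Continuum.NE9PieceCouplingModulusProj

end
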